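import Summits.PneNP.PneNP.Theorems.KarlinRubinMonotoneBlindDelta
import Summits.PneNP.PneNP.Theorems.KarlinRubinMonotoneSufficesLocality
import Literature.Computability.AlgebraicComplexity.RandomRestrictionCounting
import Literature.Probability.RandomGraphs.PlantedCliqueUnique

/-!
# Route KarlinRubin, crux `MonotoneBlind` (stmt-PneNP-18027): the witness lemma and term counts (DNF line, level 1)

Counting lemmas (exact, over `ℕ`) for the depth-2 case of the crux — quiet polynomial-size monotone DNFs are blind to
the planted `⌈n^{1/2-δ}⌉`-clique in `G(n,1/2)` (seat write-up `MonotoneBlind_DNF.md` on the item). A monotone DNF on the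
edges of `Kₙ` is given by its family of terms `𝓛` (finite sets of edge slots); it accepts `y` iff `∃ E ∈ 𝓛, E ⊆ y`.
For a planted set `A`, an edge slot `e` is *inside* `A` if both endpoints lie in `A` (then `plant A x e = true`), and
`E.filter (inside A)` are the planted edges of the term `E`.

* `card_filter_eq_off_le` — bit vectors prescribed off a set `D` number `≤ 2^{|D|}`;
* `dnf_witness_count` — **the witness lemma**: if every term of `𝓛` has at most `t` edges inside `A`, then
  `#{x : some E ∈ 𝓛 lies in plant A x} ≤ 2^t · #{x : some E ∈ 𝓛 lies in x}` (fiberwise over `y = plant A x`: inside a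
  fiber containing a witness `E₀`, forcing the `≤ t` planted edges of `E₀` to be present already puts `E₀` inside `x`);
  averaged over `A` this says that QUIETNESS forces planted witnesses to be clique-heavy;
* `card_kSubsets_filter_superset_mul_le`, `card_kSubsets_filter_le_card_inter_mul_le` — the hypergeometric tail by a
  union bound: `#{A : |A ∩ V| ≥ q} · n^q ≤ #kSubsets · C(|V|,q) · d^q` (`d = min k n`; Kumar–Saraf row count);
* `card_filter_inside_le_choose` — a term has at most `C(|A ∩ V(E)|, 2)` edges inside `A`;
* `card_filter_plant_forall_mul_le` — `#{x : E ⊆ plant A x} · 2^{|E| - |E.filter (inside A)|} ≤ 2^{C(n,2)}`.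

All `--supports stmt-PneNP-18027`; no definitions (the predicates are written inline).
-/

set_option linter.dupNamespace false -- `Summit.PneNP.PneNP.…`: summit = sub-problem (D-0017)

namespace Summit.PneNP.PneNP.Theorems

open Finset
open Literature.Computability.Complexity
open Literature.Probability.RandomGraphs.PlantedClique

variable {n : ℕ}

/-! ### Planting, edge by edge -/

/-- `plant A x e = true` iff the slot was on or lies inside `A`. [folklore] -/
theorem plant_apply_eq_true_iff (A : Finset (Fin n)) (x : EdgeVec n)
    (e : (⊤ : SimpleGraph (Fin n)).edgeSet) :
    plant A x e = true ↔ x e = true ∨ ∀ v ∈ (e : Sym2 (Fin n)), v ∈ A := by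
  classical
  simp [plant]

/-- A slot inside `A` is on after planting. [folklore] -/
theorem plant_apply_of_inside (A : Finset (Fin n)) (x : EdgeVec n)
    (e : (⊤ : SimpleGraph (Fin n)).edgeSet) (he : ∀ v ∈ (e : Sym2 (Fin n)), v ∈ A) :
    plant A x e = true :=
  (plant_apply_eq_true_iff A x e).2 (Or.inr he)

/-- A term lies in the planted graph iff its slots NOT inside `A` are on. [folklore] -/
theorem forall_plant_eq_true_iff (A : Finset (Fin n)) (x : EdgeVec n)
    (E : Finset (⊤ : SimpleGraph (Fin n)).edgeSet) :
    (∀ e ∈ E, plant A x e = true) ↔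
      ∀ e ∈ E, (¬ ∀ v ∈ (e : Sym2 (Fin n)), v ∈ A) → x e = true := by
  refine forall₂_congr fun e _ => ?_
  rw [plant_apply_eq_true_iff]
  tauto

/-! ### Bit vectors prescribed off a set -/

/-- The bit vectors agreeing with `z` outside `D` number at most `2^{|D|}` (restriction to `D` is injective on them).
[folklore] -/
theorem card_filter_eq_off_le {ι : Type*} [Fintype ι] [DecidableEq ι] (D : Finset ι) (z : ι → Bool) :
    #(univ.filter fun x : ι → Bool => ∀ e, e ∉ D → x e = z e) ≤ 2 ^ #D := by
  classical
  have h := Finset.card_le_card_of_injOn (s := univ.filter fun x : ι → Bool => ∀ e, e ∉ D → x e = z e)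
    (t := (univ : Finset (D → Bool))) (fun x => fun d : D => x d) (fun _ _ => mem_coe.2 (mem_univ _)) ?_
  · simpa [Fintype.card_fun, Fintype.card_coe, Fintype.card_bool] using h
  · intro x hx x' hx' hxx'
    simp only [coe_filter, mem_univ, true_and, Set.mem_setOf_eq] at hx hx'
    funext e
    by_cases he : e ∈ D
    · exact congr_fun hxx' ⟨e, he⟩
    · rw [hx e he, hx' e he]

/-! ### The witness lemma -/

/-- **Witness lemma (counting form).** Let `A` be a vertex set and `𝓛` a family of terms each having at most `t`
edge slots inside `A`. Then the inputs whose PLANTED graph contains a term of `𝓛` are at most `2^t` times as many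
as the inputs that contain a term of `𝓛` themselves. Proof: fibre over `y = plant A x` (the fibre forgets the bits
inside `A`); in a fibre whose `y` contains `E₀ ∈ 𝓛`, every `x` that is on along the `≤ t` slots of `E₀` inside `A`
contains `E₀`, and these are at least a `2^{-t}` fraction of the fibre (`card_filter_eq_off_le`). [folklore] -/
theorem dnf_witness_count (A : Finset (Fin n)) (𝓛 : Finset (Finset (⊤ : SimpleGraph (Fin n)).edgeSet)) (t : ℕ)
    (ht : ∀ E ∈ 𝓛, #(E.filter fun e : (⊤ : SimpleGraph (Fin n)).edgeSet => ∀ v ∈ (e : Sym2 (Fin n)), v ∈ A) ≤ t) :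
    #(univ.filter fun x : EdgeVec n => ∃ E ∈ 𝓛, ∀ e ∈ E, plant A x e = true) ≤
      2 ^ t * #(univ.filter fun x : EdgeVec n => ∃ E ∈ 𝓛, ∀ e ∈ E, x e = true) := by
  classical
  set L := univ.filter fun x : EdgeVec n => ∃ E ∈ 𝓛, ∀ e ∈ E, plant A x e = true with hL
  set R := univ.filter fun x : EdgeVec n => ∃ E ∈ 𝓛, ∀ e ∈ E, x e = true with hR
  -- fibrewise over `y = plant A x`
  rw [card_eq_sum_card_fiberwise (f := plant A) (t := (univ : Finset (EdgeVec n))) fun _ _ => mem_univ _,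
    card_eq_sum_card_fiberwise (f := plant A) (s := R) (t := (univ : Finset (EdgeVec n)))
      fun _ _ => mem_univ _, mul_sum]
  refine sum_le_sum fun y _ => ?_
  -- one fibre
  by_cases hLy : (L.filter fun x => plant A x = y) = ∅
  · rw [hLy, card_empty]; exact Nat.zero_le _
  obtain ⟨x₀, hx₀⟩ := nonempty_iff_ne_empty.2 hLy
  rw [mem_filter, hL, mem_filter] at hx₀
  obtain ⟨⟨-, E₀, hE₀, hE₀y⟩, hx₀y⟩ := hx₀
  -- `y` is on inside `A` and contains `E₀`
  have hyA : ∀ e : (⊤ : SimpleGraph (Fin n)).edgeSet, (∀ v ∈ (e : Sym2 (Fin n)), v ∈ A) → y e = true := by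
    intro e he; rw [← hx₀y]; exact plant_apply_of_inside A x₀ e he
  have hyE : ∀ e ∈ E₀, y e = true := by intro e he; rw [← hx₀y]; exact hE₀y e he
  -- the planted slots of `E₀`
  set D := E₀.filter fun e : (⊤ : SimpleGraph (Fin n)).edgeSet => ∀ v ∈ (e : Sym2 (Fin n)), v ∈ A with hD
  have hDt : #D ≤ t := ht E₀ hE₀
  -- the fibre and the map `g` switching the slots of `D` on
  set Fib := univ.filter fun x : EdgeVec n => plant A x = y with hFib
  let g : EdgeVec n → EdgeVec n := fun x e => if e ∈ D then true else x e
  have hg_off : ∀ x e, e ∉ D → g x e = x e := fun x e he => by simp [g, he]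
  have hg_on : ∀ x e, e ∈ D → g x e = true := fun x e he => by simp [g, he]
  have hplant_g : ∀ x ∈ Fib, plant A (g x) = y := by
    intro x hx
    rw [hFib, mem_filter] at hx
    funext e
    by_cases he : ∀ v ∈ (e : Sym2 (Fin n)), v ∈ A
    · rw [plant_apply_of_inside A _ e he, hyA e he]
    · have heD : e ∉ D := fun h => he (mem_filter.1 h).2
      rw [plant_apply_of_not_inside A _ e he, hg_off x e heD, ← plant_apply_of_not_inside A x e he, hx.2]
  have hgE : ∀ x ∈ Fib, ∀ e ∈ E₀, g x e = true := by
    intro x hx e he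
    rw [hFib, mem_filter] at hx
    by_cases heA : ∀ v ∈ (e : Sym2 (Fin n)), v ∈ A
    · exact hg_on x e (mem_filter.2 ⟨he, heA⟩)
    · have heD : e ∉ D := fun h => heA (mem_filter.1 h).2
      rw [hg_off x e heD, ← plant_apply_of_not_inside A x e heA, hx.2]
      exact hyE e he
  have himage : Fib.image g ⊆ R.filter fun x => plant A x = y := by
    intro z hz
    rw [mem_image] at hz
    obtain ⟨x, hx, rfl⟩ := hz
    rw [mem_filter, hR, mem_filter]
    exact ⟨⟨mem_univ _, E₀, hE₀, hgE x hx⟩, hplant_g x hx⟩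
  have hfibre : ∀ z ∈ Fib.image g, #(Fib.filter fun x => g x = z) ≤ 2 ^ t := by
    intro z _
    calc #(Fib.filter fun x => g x = z)
        ≤ #(univ.filter fun x : EdgeVec n => ∀ e, e ∉ D → x e = z e) := by
          refine card_le_card fun x hx => ?_
          rw [mem_filter] at hx
          rw [mem_filter]
          refine ⟨mem_univ _, fun e he => ?_⟩
          rw [← hx.2, hg_off x e he]
      _ ≤ 2 ^ #D := card_filter_eq_off_le D z
      _ ≤ 2 ^ t := Nat.pow_le_pow_right two_pos hDt
  calc #(L.filter fun x => plant A x = y)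
      ≤ #Fib := card_le_card fun x hx => by
          rw [mem_filter] at hx; rw [hFib, mem_filter]; exact ⟨mem_univ _, hx.2⟩
    _ ≤ 2 ^ t * #(Fib.image g) := card_le_mul_card_image _ _ hfibre
    _ ≤ 2 ^ t * #(R.filter fun x => plant A x = y) := Nat.mul_le_mul_left _ (card_le_card himage)

/-- **Witness lemma, monotone form.** As `dnf_witness_count`, with the right-hand side enlarged to any super-family
`𝓔 ⊇ 𝓛` (the whole DNF). [folklore] -/
theorem dnf_witness_count_mono (A : Finset (Fin n)) {𝓛 𝓔 : Finset (Finset (⊤ : SimpleGraph (Fin n)).edgeSet)}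
    (h𝓛 : 𝓛 ⊆ 𝓔) (t : ℕ) (ht : ∀ E ∈ 𝓛, #(E.filter fun e : (⊤ : SimpleGraph (Fin n)).edgeSet => ∀ v ∈ (e : Sym2 (Fin n)), v ∈ A) ≤ t) :
    #(univ.filter fun x : EdgeVec n => ∃ E ∈ 𝓛, ∀ e ∈ E, plant A x e = true) ≤
      2 ^ t * #(univ.filter fun x : EdgeVec n => ∃ E ∈ 𝓔, ∀ e ∈ E, x e = true) := by
  refine (dnf_witness_count A 𝓛 t ht).trans (Nat.mul_le_mul_left _ (card_le_card fun x hx => ?_))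
  rw [mem_filter] at hx ⊢
  obtain ⟨-, E, hE, h⟩ := hx
  exact ⟨mem_univ _, E, h𝓛 hE, h⟩

/-! ### The hypergeometric tail (union bound) -/

/-- A fixed vertex set `U` lies inside a uniformly random member of `kSubsets n k` with probability `≤ (d/n)^{|U|}`,
`d = min k n`; cross-multiplied (Kumar–Saraf row count). [folklore] -/
theorem card_kSubsets_filter_superset_mul_le (U : Finset (Fin n)) (k : ℕ) :
    #((kSubsets n k).filter fun S => U ⊆ S) * n ^ #U ≤ #(kSubsets n k) * (min k n) ^ #U := by
  classical
  have h := Literature.Computability.AlgebraicComplexity.KumarSaraf.card_powersetCard_filter_superset_mul_le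
    (univ : Finset (Fin n)) U (min k n)
  rw [card_univ, Fintype.card_fin] at h
  rw [card_kSubsets_eq_choose, kSubsets]
  exact h

/-- **Tail by a union bound.** `#{A ∈ kSubsets : |A ∩ V| ≥ q} · n^q ≤ #kSubsets · C(|V|,q) · d^q`: a `k`-set meeting
`V` in `≥ q` vertices contains one of the `C(|V|,q)` `q`-subsets of `V`. [folklore] -/
theorem card_kSubsets_filter_le_card_inter_mul_le (V : Finset (Fin n)) (k q : ℕ) :
    #((kSubsets n k).filter fun S => q ≤ #(S ∩ V)) * n ^ q ≤
      #(kSubsets n k) * ((#V).choose q * (min k n) ^ q) := by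
  classical
  have hcover : ((kSubsets n k).filter fun S => q ≤ #(S ∩ V)) ⊆
      (powersetCard q V).biUnion fun U => (kSubsets n k).filter fun S => U ⊆ S := by
    intro S hS
    rw [mem_filter] at hS
    obtain ⟨U, hUsub, hUcard⟩ := exists_subset_card_eq hS.2
    rw [mem_biUnion]
    refine ⟨U, mem_powersetCard.2 ⟨fun v hv => (mem_inter.1 (hUsub hv)).2, hUcard⟩, ?_⟩
    exact mem_filter.2 ⟨hS.1, fun v hv => (mem_inter.1 (hUsub hv)).1⟩
  calc #((kSubsets n k).filter fun S => q ≤ #(S ∩ V)) * n ^ q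
      ≤ #((powersetCard q V).biUnion fun U => (kSubsets n k).filter fun S => U ⊆ S) * n ^ q :=
        Nat.mul_le_mul_right _ (card_le_card hcover)
    _ ≤ (∑ U ∈ powersetCard q V, #((kSubsets n k).filter fun S => U ⊆ S)) * n ^ q :=
        Nat.mul_le_mul_right _ card_biUnion_le
    _ = ∑ U ∈ powersetCard q V, #((kSubsets n k).filter fun S => U ⊆ S) * n ^ #U := by
        rw [sum_mul]
        refine sum_congr rfl fun U hU => ?_
        rw [(mem_powersetCard.1 hU).2]
    _ ≤ ∑ U ∈ powersetCard q V, #(kSubsets n k) * (min k n) ^ #U :=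
        sum_le_sum fun U _ => card_kSubsets_filter_superset_mul_le U k
    _ = #(kSubsets n k) * ((#V).choose q * (min k n) ^ q) := by
        rw [sum_congr rfl fun U hU => by rw [(mem_powersetCard.1 hU).2], sum_const, card_powersetCard,
          smul_eq_mul]
        ring

/-! ### One term: planted edges and the count of inputs containing it after planting -/

/-- The vertices of an edge slot of `Kₙ`, as a finset, have two elements. [folklore] -/
theorem card_filter_mem_edge (e : (⊤ : SimpleGraph (Fin n)).edgeSet) :
    #(univ.filter fun v : Fin n => v ∈ (e : Sym2 (Fin n))) = 2 := by
  classical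
  obtain ⟨e, he⟩ := e
  induction e using Sym2.ind with
  | _ a b =>
    have hab : a ≠ b := by simpa [SimpleGraph.mem_edgeSet] using he
    have : (univ.filter fun v : Fin n => v ∈ (s(a, b) : Sym2 (Fin n))) = {a, b} := by
      ext v; simp [Sym2.mem_iff]
    simp only [this, card_pair hab]

/-- **A term has at most `C(|A ∩ V(E)|, 2)` slots inside `A`**: such a slot is a `2`-subset of `A ∩ V(E)`, where
`V(E)` are the vertices met by `E`. [folklore] -/
theorem card_filter_inside_le_choose (A : Finset (Fin n)) (E : Finset (⊤ : SimpleGraph (Fin n)).edgeSet) :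
    #(E.filter fun e : (⊤ : SimpleGraph (Fin n)).edgeSet => ∀ v ∈ (e : Sym2 (Fin n)), v ∈ A) ≤
      (#(A ∩ univ.filter fun v : Fin n => ∃ e ∈ E, v ∈ (e : Sym2 (Fin n)))).choose 2 := by
  classical
  set W := A ∩ univ.filter fun v : Fin n => ∃ e ∈ E, v ∈ (e : Sym2 (Fin n)) with hW
  rw [← card_powersetCard 2 W]
  refine card_le_card_of_injOn (fun e => univ.filter fun v : Fin n => v ∈ (e : Sym2 (Fin n)))
    (fun e he => ?_) ?_
  · rw [mem_coe, mem_filter] at he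
    rw [mem_coe, mem_powersetCard]
    refine ⟨fun v hv => ?_, card_filter_mem_edge e⟩
    rw [mem_filter] at hv
    rw [hW, mem_inter, mem_filter]
    exact ⟨he.2 v hv.2, mem_univ _, e, he.1, hv.2⟩
  · intro e _ e' _ hee'
    apply Subtype.ext
    refine Sym2.ext fun v => ?_
    have := congr_arg (fun s : Finset (Fin n) => v ∈ s) hee'
    simpa using this

/-- The slots of a term split into those inside `A` and the others. [folklore] -/
theorem card_filter_not_inside_eq (A : Finset (Fin n)) (E : Finset (⊤ : SimpleGraph (Fin n)).edgeSet) :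
    #(E.filter fun e : (⊤ : SimpleGraph (Fin n)).edgeSet => ¬ ∀ v ∈ (e : Sym2 (Fin n)), v ∈ A) =
      #E - #(E.filter fun e : (⊤ : SimpleGraph (Fin n)).edgeSet => ∀ v ∈ (e : Sym2 (Fin n)), v ∈ A) := by
  classical
  have h := Finset.card_filter_add_card_filter_not (s := E) (p := fun e : (⊤ : SimpleGraph (Fin n)).edgeSet => ∀ v ∈ (e : Sym2 (Fin n)), v ∈ A)
  omega

/-- **Inputs whose planted graph contains a fixed term.** `#{x : E ⊆ plant A x} · 2^{|E| - |E ∩ inside A|} ≤ 2^{#slots}`: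
the slots of `E` not inside `A` must be on in `x` itself (`card_filter_forall_eq_true_mul_le`). [folklore] -/
theorem card_filter_plant_forall_mul_le (A : Finset (Fin n)) (E : Finset (⊤ : SimpleGraph (Fin n)).edgeSet) :
    #(univ.filter fun x : EdgeVec n => ∀ e ∈ E, plant A x e = true) *
        2 ^ (#E - #(E.filter fun e : (⊤ : SimpleGraph (Fin n)).edgeSet => ∀ v ∈ (e : Sym2 (Fin n)), v ∈ A)) ≤
      2 ^ Fintype.card (⊤ : SimpleGraph (Fin n)).edgeSet := by
  classical
  set D := E.filter fun e : (⊤ : SimpleGraph (Fin n)).edgeSet => ¬ ∀ v ∈ (e : Sym2 (Fin n)), v ∈ A with hD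
  have hset : (univ.filter fun x : EdgeVec n => ∀ e ∈ E, plant A x e = true) =
      univ.filter fun x : EdgeVec n => ∀ e ∈ D, x e = true := by
    ext x
    simp only [mem_filter, mem_univ, true_and, forall_plant_eq_true_iff, hD]
    constructor
    · intro h e he
      exact h e he.1 he.2
    · intro h e he hne
      exact h e ⟨he, hne⟩
  rw [hset, ← card_filter_not_inside_eq A E]
  exact card_filter_forall_eq_true_mul_le D

end Summit.PneNP.PneNP.Theorems
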